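import Summits.QuantumFields.YangMills.Theorems.BalabanUVNodesN15KingModelComplexLinkNeumann
import Summits.QuantumFields.YangMills.Theorems.BalabanUVNodesN15KingModelCovariantDecay
import HarnessLib
/-!
# BalabanUVNodes ∕ N15 — THE KING-MODEL RUNG (PART Ϛ-c): «THE EXTENDED OPERATORS SATISFY ALL THE INEQUALITIES … CORRESPONDINGLY» — the decay, diagonal, mass and row∕column-sum bounds of the
# covariant fine covariance on the whole complex window `‖U(b)‖, ‖V(b)‖ ≤ 1+ε`, `2(d+1)cε < m²`, read off King's `A = 0` kernel at the SHIFTED parameters `((1+ε)c, m²−2(d+1)cε)` BY NAME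
# (Track A, DAG node N15 = NE2; FAN-OUT v1.1 §N15 s3 «KING-MODEL RUNG … + what the curved case adds»; count-neutral)
HONEST FRAMING.  Count-neutral (cell `pub-ymgap`, seat `pub-ymgap-dag-n15-e` g43; `--supports stmt-QuantumFields-27247 --as helper` = K3ᴬ, KEY MAP v3).  One finite torus at fixed
spacing; King's `A = 0` model, FINE covariance layer only; nothing of Bałaban's (3.42) ∕ Thm 3.4 for `G(U)` asserted; nothing continuum ∕ ℝ⁴ ∕ OS ∕ Clay; NOT a node discharge.
WHAT IS DECIDED.  [Balaban1985BackgroundPropagators] Thm 3.4 p.400: «The extended operators satisfy all the inequalities of Theorems 3.1–3.3 correspondingly.»  PART Ϛ-b proved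
`‖(G_{U,V})_{xy}‖_{op} ≤ G′(x,y)`, `G′ = (lapF K ((1+ε)c) (m²−2(d+1)cε))⁻¹` = King's `A = 0` covariance at the shifted parameters; this file reads off, BY NAME from the `A = 0` files
(PART Ε-d `abs_lapF_inv_le_exp_tdistT`, Ε∕Ϟ `abs_lapF_inv_le_diag`, `lapF_inv_diag_le_inv_mass`, Ϟ-s `sum_lapF_inv_eq_inv_mass`, Ν-a `lapF_inv_comm`), the window versions of
PART Ͱ-e's unitary-field bounds — every constant is King's at `((1+ε)c, m²−2(d+1)cε)`:
★★★ `l2_opNorm_blk_cxLapF_inv_le_exp_tdistT` (UNIFORM EXPONENTIAL DECAY on the window: `≤ (2∕m′²)·periodConst κ′_F d·e^{−(κ′_F∕(d+1))·tdistT K x y}`, `m′² = m²−2(d+1)cε`,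
`κ′_F = kappaFree ((1+ε)c) m′² d`), `norm_cxLapF_inv_entry_le_exp_tdistT`; ★★ `l2_opNorm_blk_cxLapF_inv_le_diag` (`≤ G′(x,x)`), ★★ `l2_opNorm_blk_cxLapF_inv_le_inv_mass` (`≤ 1∕m′²`),
`norm_cxLapF_inv_entry_le_inv_mass`; ★★ `sum_l2_opNorm_blk_cxLapF_inv_le` ∕ `sum_l2_opNorm_blk_cxLapF_inv_le'` (ROW and COLUMN sums `≤ 1∕m′²` — the `ℓ^∞ → ℓ^∞` and `ℓ¹ → ℓ¹` norms of
the analytic extension are `≤ 1∕(m²−2(d+1)cε)` uniformly in the volume, the fibre and the field), `sum_norm_cxLapF_inv_entry_le`(′); ★ `shifted_mass_le` (`m′² ≤ m²`: every window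
constant is WORSE than the unitary one, equal at `ε = 0`).
PRIOR TREE ART (by name): Ϛ-b (`l2_opNorm_blk_cxLapF_inv_le`, `norm_cxLapF_inv_entry_le`, `shifted_mass_pos`, `shifted_weight_nonneg`), Ε-d (`abs_lapF_inv_le_exp_tdistT`, `kappaFree`,
`periodConst`), `…TorusPlaneWaves` (`abs_lapF_inv_le_diag`, `lapF_inv_diag_le_inv_mass`), Ϟ-s (`sum_lapF_inv_eq_inv_mass`), Ν-a (`lapF_inv_comm`).  Dedup (rg at filing): basename
0 files; needles `cxLapF_inv_le_exp_tdistT|cxLapF_inv_le_inv_mass|sum_l2_opNorm_blk_cxLapF_inv_le` 0 tree files.  Locators: [Balaban1985BackgroundPropagators] Thm 3.4 p.400, (3.39)∕(3.42)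
p.397; [King1986] (4.4) p.670, (4.38) p.674; [Balaban1984PropagatorsI] p.38 (1.126).  0 `sorry`, 0 `def`.
-/

noncomputable section
open scoped BigOperators ComplexConjugate ComplexOrder Matrix.Norms.L2Operator
open Finset Matrix

namespace Summit.QuantumFields.YangMills.BalabanUVNodes.N15KingModelRung.Covariant

open Literature.MathematicalPhysics.QuantumFieldTheory.LatticeDiamagneticInequality (Hopping blk)
open Literature.MathematicalPhysics.QuantumFieldTheory.Balaban1983to89.B5Prop11Plancherel (Tor unitVec)
open Literature.MathematicalPhysics.QuantumFieldTheory.Balaban1983to89.B4TorusKernel (periodConst)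
open Literature.MathematicalPhysics.QuantumFieldTheory.King1986.Torus (lapF tdistT)
open Summit.QuantumFields.YangMills.BalabanUVNodes.N15KingModelRung.TorusSpectral (kappaFree abs_lapF_inv_le_exp_tdistT sum_lapF_inv_eq_inv_mass lapF_inv_comm
  abs_lapF_inv_le_diag lapF_inv_diag_le_inv_mass)

variable {d : ℕ} (K : Fin (d + 1) → ℕ) [hK : ∀ μ, NeZero (K μ)]
variable {𝕜 : Type*} [RCLike 𝕜] {n : Type*} [Fintype n] [DecidableEq n] {c m2 ε : ℝ}

/-- ★ THE PRICE OF COMPLEXIFICATION: the shifted mass `m′² = m² − 2(d+1)cε` is at most `m²` (`c, ε ≥ 0`), with equality at `ε = 0`. [cite: Balaban1985BackgroundPropagators, Thm 3.4 p.400] -/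
theorem shifted_mass_le (hc : 0 ≤ c) (hε : 0 ≤ ε) : m2 - 2 * ((d : ℝ) + 1) * c * ε ≤ m2 := by
  have : 0 ≤ 2 * ((d : ℝ) + 1) * c * ε := by positivity
  linarith

/-! ## §1 Uniform exponential decay on the window -/

/-- ★★★ **UNIFORM EXPONENTIAL DECAY OF THE ANALYTIC EXTENSION** (fibre operator norm): on the window `‖U(b)‖, ‖V(b)‖ ≤ 1+ε`, `2(d+1)cε < m²`,
`‖(G_{U,V})_{xy}‖_{op} ≤ (2∕m′²)·periodConst κ′_F d·e^{−(κ′_F∕(d+1))·tdistT K x y}` with King's `A = 0` constants at `((1+ε)c, m′² = m²−2(d+1)cε)` (PART Ε-d), uniformly in the volume,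
the fibre and the field. [cite: Balaban1985BackgroundPropagators, Thm 3.4 p.400, (3.42) p.397; King1986, (4.4) p.670, (4.38) p.674; Balaban1984PropagatorsI, p.38 (1.126)] -/
theorem l2_opNorm_blk_cxLapF_inv_le_exp_tdistT (hc : 0 ≤ c) (hm : 0 < m2) (hε : 0 ≤ ε) (hwin : 2 * ((d : ℝ) + 1) * c * ε < m2)
    {U V : Tor K × Fin (d + 1) → Matrix n n 𝕜} (hU : ∀ b, ‖U b‖ ≤ 1 + ε) (hV : ∀ b, ‖V b‖ ≤ 1 + ε) (x y : Tor K) :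
    ‖blk (cxLapF K c m2 U V)⁻¹ x y‖
      ≤ 2 / (m2 - 2 * ((d : ℝ) + 1) * c * ε) * periodConst (kappaFree ((1 + ε) * c) (m2 - 2 * ((d : ℝ) + 1) * c * ε) d) d
          * Real.exp (-(kappaFree ((1 + ε) * c) (m2 - 2 * ((d : ℝ) + 1) * c * ε) d / (d + 1) * tdistT K x y)) :=
  (l2_opNorm_blk_cxLapF_inv_le K hc hm hε hwin hU hV x y).trans
    ((le_abs_self _).trans (abs_lapF_inv_le_exp_tdistT K (shifted_weight_nonneg hc hε) (shifted_mass_pos hwin) x y))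

/-- ★★ ENTRYWISE DECAY on the window: `|G_{U,V}((x,i),(y,j))| ≤ (2∕m′²)·periodConst κ′_F d·e^{−(κ′_F∕(d+1))·tdistT K x y}`.
[cite: Balaban1985BackgroundPropagators, Thm 3.4 p.400, (3.42) p.397; King1986, (4.38) p.674] -/
theorem norm_cxLapF_inv_entry_le_exp_tdistT (hc : 0 ≤ c) (hm : 0 < m2) (hε : 0 ≤ ε) (hwin : 2 * ((d : ℝ) + 1) * c * ε < m2)
    {U V : Tor K × Fin (d + 1) → Matrix n n 𝕜} (hU : ∀ b, ‖U b‖ ≤ 1 + ε) (hV : ∀ b, ‖V b‖ ≤ 1 + ε) (x y : Tor K) (i j : n) :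
    ‖(cxLapF K c m2 U V)⁻¹ (x, i) (y, j)‖
      ≤ 2 / (m2 - 2 * ((d : ℝ) + 1) * c * ε) * periodConst (kappaFree ((1 + ε) * c) (m2 - 2 * ((d : ℝ) + 1) * c * ε) d) d
          * Real.exp (-(kappaFree ((1 + ε) * c) (m2 - 2 * ((d : ℝ) + 1) * c * ε) d / (d + 1) * tdistT K x y)) :=
  (norm_cxLapF_inv_entry_le K hc hm hε hwin hU hV x y i j).trans
    ((le_abs_self _).trans (abs_lapF_inv_le_exp_tdistT K (shifted_weight_nonneg hc hε) (shifted_mass_pos hwin) x y))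

/-! ## §2 Diagonal and mass bounds on the window -/

/-- ★★ OFF-DIAGONAL BLOCKS ARE BELOW THE SHIFTED DIAGONAL: `‖(G_{U,V})_{xy}‖_{op} ≤ G′(x,x)`. [cite: Balaban1985BackgroundPropagators, Thm 3.4 p.400; King1986, (4.4) p.670] -/
theorem l2_opNorm_blk_cxLapF_inv_le_diag (hc : 0 ≤ c) (hm : 0 < m2) (hε : 0 ≤ ε) (hwin : 2 * ((d : ℝ) + 1) * c * ε < m2)
    {U V : Tor K × Fin (d + 1) → Matrix n n 𝕜} (hU : ∀ b, ‖U b‖ ≤ 1 + ε) (hV : ∀ b, ‖V b‖ ≤ 1 + ε) (x y : Tor K) :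
    ‖blk (cxLapF K c m2 U V)⁻¹ x y‖ ≤ (lapF K ((1 + ε) * c) (m2 - 2 * ((d : ℝ) + 1) * c * ε))⁻¹ x x :=
  (l2_opNorm_blk_cxLapF_inv_le K hc hm hε hwin hU hV x y).trans
    ((le_abs_self _).trans (abs_lapF_inv_le_diag K (shifted_weight_nonneg hc hε) (shifted_mass_pos hwin) x y))

/-- ★★ **THE MASS BOUND ON THE WINDOW**: `‖(G_{U,V})_{xy}‖_{op} ≤ 1∕(m² − 2(d+1)cε)` for all `x, y` — the complexified covariance is bounded by the inverse SHIFTED mass, uniformly in the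
volume, the fibre and the field. [cite: Balaban1985BackgroundPropagators, Thm 3.4 p.400, (3.39) p.397; King1986, (4.4) p.670] -/
theorem l2_opNorm_blk_cxLapF_inv_le_inv_mass (hc : 0 ≤ c) (hm : 0 < m2) (hε : 0 ≤ ε) (hwin : 2 * ((d : ℝ) + 1) * c * ε < m2)
    {U V : Tor K × Fin (d + 1) → Matrix n n 𝕜} (hU : ∀ b, ‖U b‖ ≤ 1 + ε) (hV : ∀ b, ‖V b‖ ≤ 1 + ε) (x y : Tor K) :
    ‖blk (cxLapF K c m2 U V)⁻¹ x y‖ ≤ (m2 - 2 * ((d : ℝ) + 1) * c * ε)⁻¹ :=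
  (l2_opNorm_blk_cxLapF_inv_le_diag K hc hm hε hwin hU hV x y).trans
    (lapF_inv_diag_le_inv_mass K (shifted_weight_nonneg hc hε) (shifted_mass_pos hwin) x)

/-- ★★ ENTRYWISE MASS BOUND on the window: `|G_{U,V}((x,i),(y,j))| ≤ 1∕(m² − 2(d+1)cε)`. [cite: Balaban1985BackgroundPropagators, Thm 3.4 p.400, (3.39) p.397] -/
theorem norm_cxLapF_inv_entry_le_inv_mass (hc : 0 ≤ c) (hm : 0 < m2) (hε : 0 ≤ ε) (hwin : 2 * ((d : ℝ) + 1) * c * ε < m2)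
    {U V : Tor K × Fin (d + 1) → Matrix n n 𝕜} (hU : ∀ b, ‖U b‖ ≤ 1 + ε) (hV : ∀ b, ‖V b‖ ≤ 1 + ε) (x y : Tor K) (i j : n) :
    ‖(cxLapF K c m2 U V)⁻¹ (x, i) (y, j)‖ ≤ (m2 - 2 * ((d : ℝ) + 1) * c * ε)⁻¹ :=
  (norm_entry_le_l2_opNorm_blk K _ x y i j).trans (l2_opNorm_blk_cxLapF_inv_le_inv_mass K hc hm hε hwin hU hV x y)

/-! ## §3 Row and column sums on the window -/

/-- ★★ **ROW SUMS**: `Σ_y‖(G_{U,V})_{xy}‖_{op} ≤ Σ_yG′(x,y) = 1∕(m² − 2(d+1)cε)` (Ϟ-s sum rule at the shifted parameters) — the `ℓ^∞ → ℓ^∞` norm of the analytic extension is at most the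
inverse shifted mass. [cite: Balaban1985BackgroundPropagators, Thm 3.4 p.400, (3.39)∕(3.42) p.397; King1986, (2.17) p.653, (4.4) p.670] -/
theorem sum_l2_opNorm_blk_cxLapF_inv_le (hc : 0 ≤ c) (hm : 0 < m2) (hε : 0 ≤ ε) (hwin : 2 * ((d : ℝ) + 1) * c * ε < m2)
    {U V : Tor K × Fin (d + 1) → Matrix n n 𝕜} (hU : ∀ b, ‖U b‖ ≤ 1 + ε) (hV : ∀ b, ‖V b‖ ≤ 1 + ε) (x : Tor K) :
    ∑ y, ‖blk (cxLapF K c m2 U V)⁻¹ x y‖ ≤ (m2 - 2 * ((d : ℝ) + 1) * c * ε)⁻¹ := by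
  rw [← sum_lapF_inv_eq_inv_mass K (shifted_weight_nonneg hc hε) (shifted_mass_pos hwin) x]
  exact Finset.sum_le_sum fun y _ => l2_opNorm_blk_cxLapF_inv_le K hc hm hε hwin hU hV x y

/-- ★★ **COLUMN SUMS** (symmetry `G′(x,y) = G′(y,x)` of King's covariance, Ν-a `lapF_inv_comm`): `Σ_x‖(G_{U,V})_{xy}‖_{op} ≤ 1∕(m² − 2(d+1)cε)` — the `ℓ¹ → ℓ¹` norm.
[cite: Balaban1985BackgroundPropagators, Thm 3.4 p.400, (3.42) p.397; King1986, (2.17) p.653, (4.4) p.670] -/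
theorem sum_l2_opNorm_blk_cxLapF_inv_le' (hc : 0 ≤ c) (hm : 0 < m2) (hε : 0 ≤ ε) (hwin : 2 * ((d : ℝ) + 1) * c * ε < m2)
    {U V : Tor K × Fin (d + 1) → Matrix n n 𝕜} (hU : ∀ b, ‖U b‖ ≤ 1 + ε) (hV : ∀ b, ‖V b‖ ≤ 1 + ε) (y : Tor K) :
    ∑ x, ‖blk (cxLapF K c m2 U V)⁻¹ x y‖ ≤ (m2 - 2 * ((d : ℝ) + 1) * c * ε)⁻¹ := by
  rw [← sum_lapF_inv_eq_inv_mass K (shifted_weight_nonneg hc hε) (shifted_mass_pos hwin) y]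
  exact Finset.sum_le_sum fun x _ =>
    (l2_opNorm_blk_cxLapF_inv_le K hc hm hε hwin hU hV x y).trans (le_of_eq (lapF_inv_comm K _ _ x y))

/-- ★ ROW SUMS OF THE ENTRIES on the window: `Σ_y|G_{U,V}((x,i),(y,j))| ≤ 1∕(m² − 2(d+1)cε)`. [cite: Balaban1985BackgroundPropagators, Thm 3.4 p.400; King1986, (2.17) p.653] -/
theorem sum_norm_cxLapF_inv_entry_le (hc : 0 ≤ c) (hm : 0 < m2) (hε : 0 ≤ ε) (hwin : 2 * ((d : ℝ) + 1) * c * ε < m2)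
    {U V : Tor K × Fin (d + 1) → Matrix n n 𝕜} (hU : ∀ b, ‖U b‖ ≤ 1 + ε) (hV : ∀ b, ‖V b‖ ≤ 1 + ε) (x : Tor K) (i j : n) :
    ∑ y, ‖(cxLapF K c m2 U V)⁻¹ (x, i) (y, j)‖ ≤ (m2 - 2 * ((d : ℝ) + 1) * c * ε)⁻¹ :=
  (Finset.sum_le_sum fun y _ => norm_entry_le_l2_opNorm_blk K _ x y i j).trans (sum_l2_opNorm_blk_cxLapF_inv_le K hc hm hε hwin hU hV x)

/-- ★ COLUMN SUMS OF THE ENTRIES on the window: `Σ_x|G_{U,V}((x,i),(y,j))| ≤ 1∕(m² − 2(d+1)cε)`. [cite: Balaban1985BackgroundPropagators, Thm 3.4 p.400; King1986, (2.17) p.653] -/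
theorem sum_norm_cxLapF_inv_entry_le' (hc : 0 ≤ c) (hm : 0 < m2) (hε : 0 ≤ ε) (hwin : 2 * ((d : ℝ) + 1) * c * ε < m2)
    {U V : Tor K × Fin (d + 1) → Matrix n n 𝕜} (hU : ∀ b, ‖U b‖ ≤ 1 + ε) (hV : ∀ b, ‖V b‖ ≤ 1 + ε) (y : Tor K) (i j : n) :
    ∑ x, ‖(cxLapF K c m2 U V)⁻¹ (x, i) (y, j)‖ ≤ (m2 - 2 * ((d : ℝ) + 1) * c * ε)⁻¹ :=
  (Finset.sum_le_sum fun x _ => norm_entry_le_l2_opNorm_blk K _ x y i j).trans (sum_l2_opNorm_blk_cxLapF_inv_le' K hc hm hε hwin hU hV y)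

/-! ## §4 The unitary slice: every window constant specialises to PART Ͱ-e's -/

/-- ★ AT `ε = 0` the window's mass bound is the unitary one, `1∕m²`: the row-sum bound of §3 at a unitary field `U`, `V = Uᴴ` reads `Σ_y‖(G_U)_{xy}‖ ≤ 1∕m²` (Ͱ-e
`sum_l2_opNorm_blk_inv_le_inv_mass`, re-derived through the window). [cite: Balaban1985BackgroundPropagators, (3.42) p.397; King1986, (2.17) p.653] -/
theorem sum_l2_opNorm_blk_inv_le_inv_mass_of_window (hc : 0 ≤ c) (hm : 0 < m2) {U : Tor K × Fin (d + 1) → Matrix n n 𝕜}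
    (hU : ∀ b, U b ∈ Matrix.unitaryGroup n 𝕜) (x : Tor K) :
    ∑ y, ‖blk (covLapF K c m2 U)⁻¹ x y‖ ≤ m2⁻¹ := by
  have hwin : 2 * ((d : ℝ) + 1) * c * 0 < m2 := by rw [mul_zero]; exact hm
  have h := sum_l2_opNorm_blk_cxLapF_inv_le K hc hm le_rfl hwin (unitary_mem_window K hU).1 (unitary_mem_window K hU).2 x
  rwa [cxLapF_adjoint, mul_zero, sub_zero] at h

end Summit.QuantumFields.YangMills.BalabanUVNodes.N15KingModelRung.Covariant

end
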